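/- Copyright: the b2b-balaban cell (near-miss cell 7), T⁴-continuum fan-out; row NE7b OWNER lineage `t4-ne7b-p1`
(gen 98) — owner elaboration v1.2 for INTERFACE REQUEST NE7b IR-97-2 ((A2) module 1 of the (α)-instance), part 1 of 2;
tower shape after, and typed ∕ filed by, the gaps seat pub-balaban-gaps-ne6 g2 (staged `B16HistoryTower` e71fca7e6d483faf;
typist under W-ne7bp1-g98-1 ∕ -2, X-read chair leaf-04; comment-only compressions for the 400-line lint, no decl touched).
Released under the licence of the surrounding project. -/
import Mathlib.Data.Fin.Tuple.Finset
import Summits.QuantumFields.BalabanUV.T4Continuum.Support.B16HistoryIndexedFamily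

/-!
# (α)-INSTANCE, milestone (A2) module 1, part 1 of 2: A K-STEP RUN IN OPERATOR FORM UN-NESTS INTO ITS HISTORY TERMS — re-open
object (α) of row NE7b (`SCOPE-alpha.md` v2.27 §5; memo `g61/NC-NE7b-alpha-OPTIONS.md` §2 (A2)); INTERFACE REQUEST NE7b IR-97-2 of
the row OWNER `t4-ne7b-p1` (name reserved by W-ne7bp1-g97-1, journal l.46254; part 2 = `B16HistoryReprInstance`)

Summits-side support leaf of the T⁴-continuum cell (rung (B)+1 on a FINITE torus only; NOT infinite volume, NOT the
mass gap, NOT Clay; NOT a proof of NE7b — the cell's OWN estimate, NOT PRINTED, NOT PROVED).  [folklore] finite-sum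
algebra over M1 part 1 (`B16RelPosOp`: `GoodClass`, `RelLinPosOp`) and Mathlib (`Fin.snoc`∕`Fin.init`, `Finset.sigma`,
Bochner bookkeeping); nothing printed is asserted, no `def … : Prop` fact of Bałaban's, no cite-tagged hypothesis, zero
`sorry`.  [Balaban1988Convergent] (0.2) p. 244 «ρ_k = RTρ_{k−1} = (RT)^kρ₀», [Balaban1989LargeFieldI] (0.4) p. 176 and
(1.3)–(1.9) p. 178 (the decomposition of unity of a step), [Balaban1989LargeFieldII] (1.71) p. 378, (1.76) p. 381, (1.79)
p. 383 are quoted as LOCATORS only.  History-DEPENDENT tower shape (gaps-ne6 g2's same-level `B16HistoryTower`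
e71fca7e6d483faf) made CROSS-LEVEL here by owner ruling W-ne7bp1-g98-2 (journal [NE7bP1-G98-TOWER-RULING]).

WHY.  Memo g61 §2 (A2): «THE ALGEBRAIC UN-NESTING INSTANCE of M1∕M2 along `T4Continuum.Realisation`: `holdsA` for the
CONCRETE term family indexed by admissible sequences (𝐓, 𝐑 linear; the decomposition of unity inserted per level);
kernel algebra, no analysis.  Alone it is contentless — it earns its keep only with (A3).»  This part is the algebra:
§1 `RelLinPosHom` = M1's `RelLinPosOp` with source ≠ target (one renormalization step maps level-`j` functions to level-`(j+1)`
functions); §2 a HISTORY TOWER `Tower P C 𝒢`: after a history `g` of `j` choices a finite set `branch j g` of ADMISSIBLE next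
large-field choices and, per choice `p`, ONE positive additive map `op j g p : RelLinPosHom (𝒢 j) (𝒢 (j+1))` (the READING of one
𝐑𝐓-step restricted to that choice — 𝐓 after the choice's characteristic functions of the inserted decomposition of unity and 𝐑's
termwise factor; DATA here, (A1c)'s to instantiate); the admissible histories `adm K : Finset (Fin K → P)`, the elementary terms
`eterm ρ₀ (K+1) h = op_K(h|_K, h_K) (eterm ρ₀ K h|_K)` (= the composite `opsAlong K h` applied to the dressed initial density,
`eterm_eq_opsAlong`) and THE LEVEL-`K` DENSITY IN TERM FORM `dens ρ₀ K := Σ_{h ∈ adm K} eterm ρ₀ K h`; **`dens_succ`** (one-step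
un-nesting), **`dens_succ_eq_apply`** ((0.2) RECOVERED: a history-blind step is the operator form `ρ_{K+1} = Σ_p op′_p ρ_K`), the
product of per-step factors `wAlong` with **`opsAlong_one_le`** ∕ `abs_eterm_le` (U1 iterated ACROSS levels — the SHAPE of (1.79)
«a product of factors coming from the successive renormalization steps»), the entropy count **`card_adm_le`** (`#adm K ≤
Π_{j<K} N j`), and **`integral_dens_eq`** (termwise integral preservation — (0.4) after the push-forward at `f = 1`, displayed —
telescopes `∫ ρ_K dμ_K = ∫ ρ₀ dμ_0`).  §6: the model good class of BOUNDED MEASURABLE functions (`bddMeas`, `integrable_of_bddMeas`,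
`intA_of_bddMeas`) discharges M2-A's `intA` display.  Part 2 inhabits M1's `HIndex`∕`Repr172R` at the cutoff with these history
terms and PROVES «(1.72) holds» for them.

NOT HERE (honest).  Which maps `op j p` are Bałaban's ((A1c): 𝐓 as the fibre integral of the averaging, 𝐑 (0.3) with
its quotients — `SubstrateROperation.rOfRecord` one level —, the decomposition (1.3)–(1.9) — `SubstrateLargeFieldNested.
lfDecompNested_total` one level); any reading of regions off a history ((A3)); any estimate.  BY-NAME EFFECT ON THE WALL
(`WALL-NE7b-P1.md` §2): NONE.  HONEST DEPENDENCY (cell): continuum YM on T⁴ ⇐ BetaPertH ∧ nine spine estimates (0/9 proved);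
BetaPertH ⇐ (D1) ∧ (D4) ∧ CAP+tail; G-an2-4 gates asym, D1 and NE2/3/4.  This file changes none of it.
-/

open Finset MeasureTheory
open Literature.MathematicalPhysics.QuantumFieldTheory.Balaban1983to89

namespace Summit.QuantumFields.BalabanUV.T4Continuum.B16HistoryReprChain

open Summit.QuantumFields.BalabanUV.T4Continuum.B16HistoryIndexedRepr

universe u

/-! ## §1 Positive additive maps BETWEEN two configuration levels, relative to good classes -/

/-- A POSITIVE ADDITIVE MAP FROM LEVEL `C` TO LEVEL `C'`, relative to the good classes `𝒢`, `𝒢'`: M1's `RelLinPosOp`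
with source and target allowed to differ (one renormalization step maps functions of the level-`j` field to functions
of the level-`(j+1)` field).  Same four laws, asked on the class. [folklore] -/
structure RelLinPosHom {C C' : Type u} (𝒢 : GoodClass C) (𝒢' : GoodClass C') where
  T : (C → ℝ) → C' → ℝ
  map_good : ∀ {F : C → ℝ}, 𝒢.Gd F → 𝒢'.Gd (T F)
  mono : ∀ {F G : C → ℝ}, 𝒢.Gd F → 𝒢.Gd G → (∀ x, F x ≤ G x) → ∀ x, T F x ≤ T G x
  add : ∀ {F G : C → ℝ}, 𝒢.Gd F → 𝒢.Gd G → ∀ x, T (fun y => F y + G y) x = T F x + T G x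
  smul : ∀ {F : C → ℝ}, 𝒢.Gd F → ∀ (c : ℝ) (x : C'), T (fun y => c * F y) x = c * T F x

namespace RelLinPosHom

variable {C C' C'' : Type u} {𝒢 : GoodClass C} {𝒢' : GoodClass C'} {𝒢'' : GoodClass C''}

/-- The identity map of a level. [folklore] -/
protected def id (𝒢 : GoodClass C) : RelLinPosHom 𝒢 𝒢 where
  T F := F
  map_good h := h
  mono _ _ h x := h x
  add _ _ _ := rfl
  smul _ _ _ := rfl

/-- Composition `P ∘ Q` across three levels. [folklore] -/
def comp (P : RelLinPosHom 𝒢' 𝒢'') (Q : RelLinPosHom 𝒢 𝒢') : RelLinPosHom 𝒢 𝒢'' where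
  T F := P.T (Q.T F)
  map_good h := P.map_good (Q.map_good h)
  mono hF hG h x := P.mono (Q.map_good hF) (Q.map_good hG) (fun y => Q.mono hF hG h y) x
  add {F G} hF hG x := by
    show P.T (Q.T (fun y => F y + G y)) x = P.T (Q.T F) x + P.T (Q.T G) x
    have e : Q.T (fun y => F y + G y) = fun y => Q.T F y + Q.T G y := funext fun y => Q.add hF hG y
    rw [e, P.add (Q.map_good hF) (Q.map_good hG)]
  smul {F} hF c x := by
    show P.T (Q.T (fun y => c * F y)) x = c * P.T (Q.T F) x
    have e : Q.T (fun y => c * F y) = fun y => c * Q.T F y := funext fun y => Q.smul hF c y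
    rw [e, P.smul (Q.map_good hF)]

/-- A same-level map IS one of M1's relative operations (and conversely, field for field). [folklore] -/
def toOp (P : RelLinPosHom 𝒢 𝒢) : RelLinPosOp 𝒢 := ⟨P.T, P.map_good, P.mono, P.add, P.smul⟩

/-- `T 0 = 0`. [folklore] -/
theorem map_zero (P : RelLinPosHom 𝒢 𝒢') (x : C') : P.T (fun _ => 0) x = 0 := by
  have h := P.smul (𝒢.const 0) 0 x
  simpa using h

/-- Positivity on the class. [folklore] -/
theorem apply_nonneg (P : RelLinPosHom 𝒢 𝒢') {F : C → ℝ} (hF : 𝒢.Gd F) (h : ∀ y, 0 ≤ F y) (x : C') :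
    0 ≤ P.T F x := by
  have h1 := P.mono (𝒢.const 0) hF h x
  rwa [P.map_zero] at h1

/-- `T1 ≥ 0`. [folklore] -/
theorem one_nonneg (P : RelLinPosHom 𝒢 𝒢') (x : C') : 0 ≤ P.T (fun _ => 1) x :=
  P.apply_nonneg (𝒢.const 1) (fun _ => zero_le_one) x

/-- `F ≤ B` good ⟹ `TF ≤ B·T1`. [folklore] -/
theorem apply_le_of_le (P : RelLinPosHom 𝒢 𝒢') {F : C → ℝ} (hF : 𝒢.Gd F) {B : ℝ} (h : ∀ y, F y ≤ B) (x : C') :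
    P.T F x ≤ B * P.T (fun _ => 1) x := by
  have h1 := P.mono hF (𝒢.smul B (𝒢.const 1)) (fun y => by simpa using h y) x
  rwa [P.smul (𝒢.const 1)] at h1

/-- `B ≤ F` good ⟹ `B·T1 ≤ TF`. [folklore] -/
theorem le_apply_of_le (P : RelLinPosHom 𝒢 𝒢') {F : C → ℝ} (hF : 𝒢.Gd F) {B : ℝ} (h : ∀ y, B ≤ F y) (x : C') :
    B * P.T (fun _ => 1) x ≤ P.T F x := by
  have h1 := P.mono (𝒢.smul B (𝒢.const 1)) hF (fun y => by simpa using h y) x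
  rwa [P.smul (𝒢.const 1)] at h1

/-- (1.73) across levels: `F` good, `|F| ≤ B` ⟹ `|TF| ≤ B·T1`. [folklore] -/
theorem abs_apply_le (P : RelLinPosHom 𝒢 𝒢') {F : C → ℝ} (hF : 𝒢.Gd F) {B : ℝ} (h : ∀ y, |F y| ≤ B) (x : C') :
    |P.T F x| ≤ B * P.T (fun _ => 1) x := by
  rw [abs_le]
  refine ⟨?_, P.apply_le_of_le hF (fun y => (abs_le.mp (h y)).2) x⟩
  have h1 := P.le_apply_of_le hF (B := -B) (fun y => (abs_le.mp (h y)).1) x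
  linarith

/-- Additivity over finite sums of good functions. [folklore] -/
theorem map_sum (P : RelLinPosHom 𝒢 𝒢') {ι : Type*} (s : Finset ι) (F : ι → C → ℝ)
    (hF : ∀ i ∈ s, 𝒢.Gd (F i)) (x : C') : P.T (fun y => ∑ i ∈ s, F i y) x = ∑ i ∈ s, P.T (F i) x := by
  classical
  induction s using Finset.induction_on with
  | empty => simpa using P.map_zero x
  | insert a s ha ih =>
      have hs : ∀ i ∈ s, 𝒢.Gd (F i) := fun i hi => hF i (Finset.mem_insert_of_mem hi)
      simp only [Finset.sum_insert ha]
      rw [← ih hs]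
      exact P.add (hF a (Finset.mem_insert_self a s)) (𝒢.sum s F hs) x

end RelLinPosHom

/-! ## §2 THE HISTORY TOWER ACROSS LEVELS (`Fin K → P` currency): history-dependent branching, one map per (history, choice) -/

section Tower

variable {P : Type} {C : ℕ → Type u} {𝒢 : (j : ℕ) → GoodClass (C j)}

/-- **A HISTORY TOWER ACROSS LEVELS**: after a history `g : Fin j → P` of `j` choices, the finite set `branch j g` of ADMISSIBLE
next choices ([B16] (1.71) p. 378 «Σ over admissible sequences», (1.76) p. 381; [B15] (1.3)–(1.9) p. 178: each step's
characteristic functions live on the regions the earlier outcomes left small — locators) and, per next choice `p`, ONE positive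
additive map `op j g p` from the level-`j` functions to the level-`(j+1)` functions (the READING of one 𝐑𝐓-step restricted to that
choice: 𝐓 after the choice's characteristic functions and 𝐑's termwise factor — DATA here, (A1c)'s to instantiate).  Nothing of
Bałaban's asserted; shape after gaps-ne6 g2's same-level `B16HistoryTower` e71fca7e6d483faf (owner ruling W-ne7bp1-g98-2). [folklore] -/
structure Tower (P : Type) (C : ℕ → Type u) (𝒢 : (j : ℕ) → GoodClass (C j)) where
  /-- admissible next choices after the history `g` of `j` steps -/
  branch : (j : ℕ) → (Fin j → P) → Finset P
  /-- the step map of the choice `p` after the history `g` -/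
  op : (j : ℕ) → (Fin j → P) → P → RelLinPosHom (𝒢 j) (𝒢 (j + 1))

namespace Tower

variable (T : Tower P C 𝒢)

/-- Appending the next choice to a history is injective (as a map on (history, choice) pairs). [folklore] -/
theorem snoc_injective (K : ℕ) :
    Function.Injective (fun gp : (Σ _ : Fin K → P, P) => (Fin.snoc gp.1 gp.2 : Fin (K + 1) → P)) := by
  rintro ⟨g, p⟩ ⟨g', p'⟩ h
  have h1 : g = g' := by simpa [Fin.init_snoc] using congrArg Fin.init h
  have h2 : p = p' := by simpa [Fin.snoc_last] using congrFun h (Fin.last K)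
  subst h1; subst h2; rfl

/-- **THE ADMISSIBLE HISTORIES OF LENGTH `K`**: the empty history; a history of length `K + 1` is an admissible history
of length `K` followed by an admissible next choice. [folklore] -/
def adm : (K : ℕ) → Finset (Fin K → P)
  | 0 => Finset.univ
  | K + 1 => ((adm K).sigma (T.branch K)).map ⟨_, snoc_injective K⟩

/-- Membership one level up: the initial segment is admissible and the last choice is an admissible next choice. [folklore] -/
theorem mem_adm_succ {K : ℕ} (h : Fin (K + 1) → P) :
    h ∈ T.adm (K + 1) ↔ Fin.init h ∈ T.adm K ∧ h (Fin.last K) ∈ T.branch K (Fin.init h) := by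
  show h ∈ ((T.adm K).sigma (T.branch K)).map ⟨_, snoc_injective K⟩ ↔ _
  rw [Finset.mem_map]
  constructor
  · rintro ⟨⟨g, p⟩, hgp, rfl⟩
    rw [Finset.mem_sigma] at hgp
    simpa [Fin.init_snoc, Fin.snoc_last] using hgp
  · rintro ⟨hg, hp⟩
    exact ⟨⟨Fin.init h, h (Fin.last K)⟩, Finset.mem_sigma.mpr ⟨hg, hp⟩, Fin.snoc_init_self h⟩

/-- Splitting the LAST choice off a sum over the admissible histories of length `K + 1`. [folklore] -/
theorem sum_adm_succ {M : Type*} [AddCommMonoid M] (K : ℕ) (F : (Fin (K + 1) → P) → M) :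
    ∑ h ∈ T.adm (K + 1), F h = ∑ g ∈ T.adm K, ∑ p ∈ T.branch K g, F (Fin.snoc g p) := by
  show ∑ h ∈ ((T.adm K).sigma (T.branch K)).map ⟨_, snoc_injective K⟩, F h = _
  rw [Finset.sum_map, Finset.sum_sigma]
  rfl

/-- **THE ENTROPY COUNT, one level**: `#adm (K+1) = Σ_{g ∈ adm K} #branch K g`. [folklore] -/
theorem card_adm_succ (K : ℕ) : (T.adm (K + 1)).card = ∑ g ∈ T.adm K, (T.branch K g).card := by
  show (((T.adm K).sigma (T.branch K)).map ⟨_, snoc_injective K⟩).card = _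
  rw [Finset.card_map, Finset.card_sigma]

/-- **THE ENTROPY COUNT**: per-level branching bounds `#branch j g ≤ N j` give `#adm K ≤ Π_{j<K} N j` (the shape of
[B16] p. 383 «summations over the admissible sequences … replaced by the factors …», locator). [folklore] -/
theorem card_adm_le (N : ℕ → ℕ) (hN : ∀ j g, (T.branch j g).card ≤ N j) :
    ∀ K, (T.adm K).card ≤ ∏ j ∈ Finset.range K, N j
  | 0 => by
      show (Finset.univ : Finset (Fin 0 → P)).card ≤ _
      simp
  | K + 1 => by
      rw [T.card_adm_succ, Finset.prod_range_succ]
      calc ∑ g ∈ T.adm K, (T.branch K g).card ≤ ∑ g ∈ T.adm K, N K := Finset.sum_le_sum fun g _ => hN K g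
        _ = (T.adm K).card * N K := by rw [Finset.sum_const, smul_eq_mul]
        _ ≤ (∏ j ∈ Finset.range K, N j) * N K := Nat.mul_le_mul_right _ (card_adm_le N hN K)

/-- **THE COMPOSITE MAP ALONG A HISTORY** `op_{K−1}(h|_{K−1}, h_{K−1}) ∘ ⋯ ∘ op_0(∅, h_0)`: level `0` → level `K`. [folklore] -/
def opsAlong : (K : ℕ) → (Fin K → P) → RelLinPosHom (𝒢 0) (𝒢 K)
  | 0, _ => RelLinPosHom.id (𝒢 0)
  | K + 1, h => (T.op K (Fin.init h) (h (Fin.last K))).comp (opsAlong K (Fin.init h))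

/-- **THE ELEMENTARY TERM OF A HISTORY** from the (dressed) initial density `ρ₀`: `eterm 0 = ρ₀`,
`eterm (K+1) h = op_K(h|_K, h_K) (eterm K h|_K)`. [folklore] -/
def eterm (ρ₀ : C 0 → ℝ) : (K : ℕ) → (Fin K → P) → C K → ℝ
  | 0, _ => ρ₀
  | K + 1, h => (T.op K (Fin.init h) (h (Fin.last K))).T (eterm ρ₀ K (Fin.init h))

/-- The elementary term IS the composite map along the history applied to `ρ₀`. [folklore] -/
theorem eterm_eq_opsAlong (ρ₀ : C 0 → ℝ) : ∀ (K : ℕ) (h : Fin K → P), T.eterm ρ₀ K h = (T.opsAlong K h).T ρ₀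
  | 0, _ => rfl
  | K + 1, h => by
      show (T.op K _ _).T (T.eterm ρ₀ K (Fin.init h)) = (T.op K _ _).T ((T.opsAlong K (Fin.init h)).T ρ₀)
      rw [eterm_eq_opsAlong ρ₀ K (Fin.init h)]

/-- **THE LEVEL-`K` DENSITY IN TERM FORM**: the finite sum of the elementary terms over the admissible histories —
[B16] (1.71)∕(1.72) pp. 378–379 read as «the density is the sum of its history terms» (locator). [folklore] -/
def dens (ρ₀ : C 0 → ℝ) (K : ℕ) : C K → ℝ := fun V => ∑ h ∈ T.adm K, T.eterm ρ₀ K h V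

/-- At level `0` the density is `ρ₀` (one empty history). [folklore] -/
theorem dens_zero (ρ₀ : C 0 → ℝ) (V : C 0) : T.dens ρ₀ 0 V = ρ₀ V := by
  show ∑ h ∈ (Finset.univ : Finset (Fin 0 → P)), ρ₀ V = ρ₀ V
  rw [Finset.univ_unique, Finset.sum_singleton]

/-- **ONE-STEP UN-NESTING**: `ρ_{K+1}(V) = Σ_{g ∈ adm K} Σ_{p ∈ branch K g} op_K(g, p) (eterm K g) (V)`. [folklore] -/
theorem dens_succ (ρ₀ : C 0 → ℝ) (K : ℕ) (V : C (K + 1)) :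
    T.dens ρ₀ (K + 1) V = ∑ g ∈ T.adm K, ∑ p ∈ T.branch K g, (T.op K g p).T (T.eterm ρ₀ K g) V := by
  unfold dens
  rw [T.sum_adm_succ]
  refine Finset.sum_congr rfl fun g _ => Finset.sum_congr rfl fun p _ => ?_
  simp [eterm, Fin.init_snoc, Fin.snoc_last]

/-- Elementary terms of a good `ρ₀` are good. [folklore] -/
theorem eterm_good {ρ₀ : C 0 → ℝ} (hρ : (𝒢 0).Gd ρ₀) (K : ℕ) (h : Fin K → P) : (𝒢 K).Gd (T.eterm ρ₀ K h) := by
  rw [T.eterm_eq_opsAlong]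
  exact (T.opsAlong K h).map_good hρ

/-- Elementary terms of a non-negative good `ρ₀` are non-negative (L1 along a history). [folklore] -/
theorem eterm_nonneg {ρ₀ : C 0 → ℝ} (hρ : (𝒢 0).Gd ρ₀) (h0 : ∀ x, 0 ≤ ρ₀ x) (K : ℕ) (h : Fin K → P) (V : C K) :
    0 ≤ T.eterm ρ₀ K h V := by
  rw [T.eterm_eq_opsAlong]
  exact (T.opsAlong K h).apply_nonneg hρ h0 V

/-- The densities are good. [folklore] -/
theorem dens_good {ρ₀ : C 0 → ℝ} (hρ : (𝒢 0).Gd ρ₀) (K : ℕ) : (𝒢 K).Gd (T.dens ρ₀ K) :=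
  (𝒢 K).sum (T.adm K) _ fun h _ => T.eterm_good hρ K h

/-- **(0.2) RECOVERED — THE HISTORY-BLIND STEP IS THE OPERATOR FORM `ρ_{K+1} = Σ_p op_p ρ_K`**: when the admissible next
choices and the step maps after every admissible history of length `K` do not depend on that history (`branch K g = S`,
`op K g p = op′ p`), additivity on the class gives `ρ_{K+1}(V) = Σ_{p ∈ S} op′_p (ρ_K)(V)` — print's «ρ_{k+1} = 𝐑𝐓ρ_k» with the
step's decomposition of unity inserted is this special case; the history-dependent step is the general one. [folklore] -/
theorem dens_succ_eq_apply {ρ₀ : C 0 → ℝ} (hρ : (𝒢 0).Gd ρ₀) (K : ℕ) (S : Finset P)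
    (op' : P → RelLinPosHom (𝒢 K) (𝒢 (K + 1))) (hb : ∀ g ∈ T.adm K, T.branch K g = S)
    (hop : ∀ g ∈ T.adm K, ∀ p ∈ S, T.op K g p = op' p) (V : C (K + 1)) :
    T.dens ρ₀ (K + 1) V = ∑ p ∈ S, (op' p).T (T.dens ρ₀ K) V := by
  rw [T.dens_succ]
  have e : ∀ g ∈ T.adm K, ∑ p ∈ T.branch K g, (T.op K g p).T (T.eterm ρ₀ K g) V =
      ∑ p ∈ S, (op' p).T (T.eterm ρ₀ K g) V := fun g hg => by
    rw [hb g hg]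
    exact Finset.sum_congr rfl fun p hp => by rw [hop g hg p hp]
  rw [Finset.sum_congr rfl e, Finset.sum_comm]
  refine Finset.sum_congr rfl fun p _ => ?_
  rw [show T.dens ρ₀ K = fun W => ∑ g ∈ T.adm K, T.eterm ρ₀ K g W from rfl,
    (op' p).map_sum (T.adm K) _ (fun g _ => T.eterm_good hρ K g) V]

/-- **THE PRODUCT OF PER-STEP FACTORS ALONG A HISTORY**: `wAlong (K+1) h = wAlong K h|_K · w K h|_K h_K`. [folklore] -/
def wAlong (w : (j : ℕ) → (Fin j → P) → P → ℝ) : (K : ℕ) → (Fin K → P) → ℝ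
  | 0, _ => 1
  | K + 1, h => wAlong w K (Fin.init h) * w K (Fin.init h) (h (Fin.last K))

/-- The product of non-negative factors is non-negative. [folklore] -/
theorem wAlong_nonneg (w : (j : ℕ) → (Fin j → P) → P → ℝ) (hw0 : ∀ j g p, 0 ≤ w j g p) :
    ∀ (K : ℕ) (h : Fin K → P), 0 ≤ wAlong w K h
  | 0, _ => zero_le_one
  | K + 1, h => mul_nonneg (wAlong_nonneg w hw0 K (Fin.init h)) (hw0 K (Fin.init h) (h (Fin.last K)))

/-- For HISTORY-BLIND factors the product along a history is the plain product over the steps. [folklore] -/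
theorem wAlong_blind (w : ℕ → P → ℝ) : ∀ (K : ℕ) (h : Fin K → P),
    wAlong (fun j (_ : Fin j → P) p => w j p) K h = ∏ j : Fin K, w j (h j)
  | 0, _ => by simp [wAlong]
  | K + 1, h => by
      show wAlong (fun j (_ : Fin j → P) p => w j p) K (Fin.init h) * w K (h (Fin.last K)) = _
      rw [wAlong_blind w K (Fin.init h), Fin.prod_univ_castSucc]
      rfl

/-- **U1 ITERATED ACROSS LEVELS — A HISTORY's UNIT WEIGHT IS AT MOST THE PRODUCT OF ITS PER-STEP FACTORS**: displayed
per-step unit-weight envelopes `op_j(g, p) 1 ≤ w j g p` (`w ≥ 0`) give `(opsAlong K h) 1 ≤ wAlong w K h` (the SHAPE of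
[B16] (1.79) p. 383 «a product of factors coming from the successive renormalization steps», locator). [folklore] -/
theorem opsAlong_one_le (w : (j : ℕ) → (Fin j → P) → P → ℝ) (hw0 : ∀ j g p, 0 ≤ w j g p)
    (hw : ∀ j g p x, (T.op j g p).T (fun _ => 1) x ≤ w j g p) :
    ∀ (K : ℕ) (h : Fin K → P) (x : C K), (T.opsAlong K h).T (fun _ => 1) x ≤ wAlong w K h
  | 0, _, x => by
      show (1 : ℝ) ≤ 1
      exact le_rfl
  | K + 1, h, x => by
      have hprod : 0 ≤ wAlong w K (Fin.init h) := wAlong_nonneg w hw0 K _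
      show (T.op K (Fin.init h) (h (Fin.last K))).T ((T.opsAlong K (Fin.init h)).T fun _ => 1) x ≤
        wAlong w K (Fin.init h) * w K (Fin.init h) (h (Fin.last K))
      calc (T.op K (Fin.init h) (h (Fin.last K))).T ((T.opsAlong K (Fin.init h)).T fun _ => 1) x
          ≤ wAlong w K (Fin.init h) * (T.op K (Fin.init h) (h (Fin.last K))).T (fun _ => 1) x :=
            (T.op K _ _).apply_le_of_le ((T.opsAlong K (Fin.init h)).map_good ((𝒢 0).const 1))
              (fun y => opsAlong_one_le w hw0 hw K (Fin.init h) y) x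
        _ ≤ wAlong w K (Fin.init h) * w K (Fin.init h) (h (Fin.last K)) :=
            mul_le_mul_of_nonneg_left (hw K _ _ x) hprod

/-- **THE HISTORY TERM UNDER ITS PRODUCT OF FACTORS**: `|ρ₀| ≤ B`, `0 ≤ B` ⟹ `|eterm K h| ≤ B·wAlong w K h`. [folklore] -/
theorem abs_eterm_le (w : (j : ℕ) → (Fin j → P) → P → ℝ) (hw0 : ∀ j g p, 0 ≤ w j g p)
    (hw : ∀ j g p x, (T.op j g p).T (fun _ => 1) x ≤ w j g p) {ρ₀ : C 0 → ℝ} (hρ : (𝒢 0).Gd ρ₀) {B : ℝ}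
    (hB0 : 0 ≤ B) (hB : ∀ y, |ρ₀ y| ≤ B) (K : ℕ) (h : Fin K → P) (V : C K) :
    |T.eterm ρ₀ K h V| ≤ B * wAlong w K h := by
  rw [T.eterm_eq_opsAlong]
  exact ((T.opsAlong K h).abs_apply_le hρ hB V).trans (mul_le_mul_of_nonneg_left (T.opsAlong_one_le w hw0 hw K h V) hB0)

/-- **THE TOTAL INTEGRAL TELESCOPES**: if, after every admissible history, the one-step operation preserves the integral
of that history's term (displayed TERMWISE: (0.4) for 𝐑 — `SubstrateROperation.integral_rOfRecord` — after 𝐓's push-forward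
identity at `f = 1`) and the terms are integrable (displayed; §6 in the model class), then `∫ ρ_K dμ_K = ∫ ρ₀ dμ_0`. [folklore] -/
theorem integral_dens_eq [∀ j, MeasurableSpace (C j)] (μ : (j : ℕ) → Measure (C j)) (ρ₀ : C 0 → ℝ)
    (hint : ∀ j g, g ∈ T.adm j → Integrable (T.eterm ρ₀ j g) (μ j))
    (hint' : ∀ j g p, g ∈ T.adm j → p ∈ T.branch j g → Integrable ((T.op j g p).T (T.eterm ρ₀ j g)) (μ (j + 1)))
    (hpres : ∀ j g, g ∈ T.adm j →
      ∫ x, (∑ p ∈ T.branch j g, (T.op j g p).T (T.eterm ρ₀ j g) x) ∂μ (j + 1) = ∫ x, T.eterm ρ₀ j g x ∂μ j) :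
    ∀ K, ∫ V, T.dens ρ₀ K V ∂μ K = ∫ U, ρ₀ U ∂μ 0
  | 0 => by simp [dens_zero]
  | K + 1 => by
      have e : (fun V => T.dens ρ₀ (K + 1) V) =
          fun V => ∑ g ∈ T.adm K, ∑ p ∈ T.branch K g, (T.op K g p).T (T.eterm ρ₀ K g) V :=
        funext (T.dens_succ ρ₀ K)
      rw [e, integral_finsetSum _ (fun g hg => integrable_finsetSum _ fun p hp => hint' K g p hg hp)]
      rw [Finset.sum_congr rfl fun g hg => hpres K g hg]
      rw [← integral_finsetSum _ fun g hg => hint K g hg]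
      exact integral_dens_eq μ ρ₀ hint hint' hpres K

end Tower

end Tower

/-! ## §6 A MODEL GOOD CLASS in which every elementary term is integrable: bounded measurable functions -/

section BddMeas

variable (X : Type) [MeasurableSpace X]

/-- The good class of BOUNDED MEASURABLE functions (the model named in M1 part 1). [folklore] -/
def bddMeas : GoodClass X where
  Gd F := Measurable F ∧ ∃ B : ℝ, ∀ x, |F x| ≤ B
  const c := ⟨measurable_const, |c|, fun _ => le_rfl⟩
  add := by
    rintro F G ⟨hF, B, hB⟩ ⟨hG, B', hB'⟩
    exact ⟨hF.add hG, B + B', fun x => (abs_add_le _ _).trans (add_le_add (hB x) (hB' x))⟩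
  smul := by
    rintro F c ⟨hF, B, hB⟩
    exact ⟨hF.const_mul c, |c| * B, fun x => by rw [abs_mul]; exact mul_le_mul_of_nonneg_left (hB x) (abs_nonneg c)⟩
  mul := by
    rintro F G ⟨hF, B, hB⟩ ⟨hG, B', hB'⟩
    refine ⟨hF.mul hG, B * B', fun x => ?_⟩
    rw [abs_mul]
    exact mul_le_mul (hB x) (hB' x) (abs_nonneg _) ((abs_nonneg _).trans (hB x))

variable {X}

/-- Under a finite measure every function of the class is integrable — discharges M2-A's `intA` display for a term
family whose elementary terms are good in this class (e.g. part 2 §5's, by `eterm_true`∕`eterm_false`, `eterm_good`). [folklore] -/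
theorem integrable_of_bddMeas (μ : Measure X) [IsFiniteMeasure μ] {F : X → ℝ} (hF : (bddMeas X).Gd F) :
    Integrable F μ := by
  obtain ⟨hm, B, hB⟩ := hF
  exact Integrable.of_bound hm.aestronglyMeasurable B (Filter.Eventually.of_forall fun x => by
    simpa [Real.norm_eq_abs] using hB x)

/-- **M2-A's `intA` DISPLAY DISCHARGED IN THE MODEL CLASS**: every elementary term of ANY (1.72)-data `R` relative to
`bddMeas X` is integrable under a finite measure (`χ_a` good × `TZh`'s image of the good `innerH`; leaf-06 opt-1). [folklore] -/
theorem intA_of_bddMeas (μ : Measure X) [IsFiniteMeasure μ] {Dom : Type*} {I : HIndex Dom}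
    (R : Repr172R (bddMeas X) I) (a : I.Adm) (ι : I.HZ × I.HL × I.HC) : Integrable (R.eterm a ι) μ :=
  integrable_of_bddMeas μ ((bddMeas X).mul (R.χ_good a) ((R.TZh a ι.1).map_good (R.innerH_good a ι)))

end BddMeas

end Summit.QuantumFields.BalabanUV.T4Continuum.B16HistoryReprChain
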